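import Mathlib
import Literature.NumberTheory.LFunctions.WeilExplicit
import Literature.NumberTheory.LFunctions.WeilExplicitProofs
import Literature.NumberTheory.LFunctions.WeilGroundEnergyProofs
import Literature.NumberTheory.LFunctions.WeilMellinBounds
import Literature.NumberTheory.LFunctions.WeilExplicitRightEdge
import Literature.Analysis.SpecialFunctions.DigammaLogBound
import HarnessLib

/-!
# Sub-goal (B) of the line `Sketch`: a uniform bound for the polarised Weil functional
(crux `WeilGroundState.GroundStatesConvergeToXi`, item stmt-RiemannHypothesis-1527)

**Statement** (`norm_weilFunctional_weilConv_weilReflect_le`). For a test function `h₀` and an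
exponent `b₀ > 1/2` there is `C ≥ 0` such that for every test function `f`
`‖W(f ⋆ h̃₀)‖ ≤ C ∫ ‖f(t)‖ e^{b₀|t|} dt`,
where `W = weilFunctional = weilPolarTerm - weilPrimeTerm + weilArchTerm` is the Weil explicit-formula
functional of `Literature/NumberTheory/LFunctions/WeilExplicit.lean`, `f ⋆ h = weilConv f h` and
`h̃₀ = weilReflect h₀`.

**Proof.** Put `K = f ⋆ h̃₀`, `I_f = ∫ ‖f‖ e^{b₀|t|}`, `H = sup ‖h₀‖`, `supp h₀ ⊆ [-r, r]`.
* Polar term: `K̂ = f̂ · (h̃₀)^` (`weilMellin_weilConv_holds`) and `‖f̂(σ)‖ ≤ ∫ ‖f‖ e^{|t|/2} ≤ I_f`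
  for `0 ≤ Re σ ≤ 1` (`norm_weilMellin_le_weilL1`, `1/2 ≤ b₀`).
* Pointwise: `‖K(x)‖ ≤ H e^{b₀ r} I_f e^{-b₀|x|}` (on the support of `h₀(u - x)` one has
  `|x| ≤ |u| + r`).
* Prime term: `‖Σ Λ(n) n^{-1/2}(K(log n) + K(-log n))‖ ≤ 2 H e^{b₀ r} I_f Σ Λ(n) n^{-1/2-b₀}`, the
  series converging because `1/2 + b₀ > 1` (`ArithmeticFunction.LSeriesSummable_vonMangoldt`).
* Archimedean term: `‖K(0)‖ log π ≤ H e^{b₀ r} I_f log π`, and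
  `‖∫ K̂(1/2+it) Re ψ(1/4+it/2) dt‖ ≤ I_f ∫ ‖(h̃₀)^(1/2+it) Re ψ(1/4+it/2)‖ dt`, the last integrand
  being integrable (`integrable_mul_weilMellin_vertical_of_norm_le_log` with the logarithmic growth
  of `ψ` on vertical lines, `exists_norm_digamma_vertical_le`).

Mathlib + the proved tree files `WeilExplicit*.lean`, `WeilMellinBounds.lean`,
`WeilExplicitRightEdge.lean`, `DigammaLogBound.lean` only; no named fact is used; no definitions.
-/

set_option linter.dupNamespace false

noncomputable section

open MeasureTheory Complex Filter Set
open scoped Real Topology ComplexConjugate ArithmeticFunction.vonMangoldt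

namespace Summit.RiemannHypothesis.RiemannHypothesis.Theorems.GroundStatesConvergeToXi

open Literature.NumberTheory.LFunctions

/-! ## Weighted `L¹` norms of a test function -/

/-- For a test function `f` and a continuous weight `w`, `‖f‖ · w` is integrable (continuous of
compact support). [folklore] -/
theorem uniformBound_integrable_norm_mul {f : ℝ → ℂ} (hf : IsWeilTest f) {w : ℝ → ℝ}
    (hw : Continuous w) : Integrable fun t : ℝ ↦ ‖f t‖ * w t :=
  (hf.1.continuous.norm.mul hw).integrable_of_hasCompactSupport hf.2.norm.mul_right

/-- `∫ ‖f‖ e^{|t|/2} ≤ ∫ ‖f‖ e^{b|t|}` for `1/2 ≤ b`. [folklore] -/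
theorem uniformBound_weilL1_le {f : ℝ → ℂ} (hf : IsWeilTest f) {b : ℝ} (hb : 1 / 2 ≤ b) :
    weilL1 f ≤ ∫ t : ℝ, ‖f t‖ * Real.exp (b * |t|) := by
  unfold weilL1
  refine integral_mono (uniformBound_integrable_norm_mul hf (by fun_prop))
    (uniformBound_integrable_norm_mul hf (by fun_prop)) fun t ↦ ?_
  dsimp only
  gcongr
  nlinarith [mul_nonneg (sub_nonneg.2 hb) (abs_nonneg t)]

/-- In the closed critical strip `0 ≤ Re s ≤ 1`: `‖f̂(s)‖ ≤ ∫ ‖f‖ e^{b|t|}` whenever `1/2 ≤ b`.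
[folklore] -/
theorem uniformBound_norm_weilMellin_le {f : ℝ → ℂ} (hf : IsWeilTest f) {b : ℝ} (hb : 1 / 2 ≤ b)
    {s : ℂ} (hs0 : 0 ≤ s.re) (hs1 : s.re ≤ 1) :
    ‖weilMellin f s‖ ≤ ∫ t : ℝ, ‖f t‖ * Real.exp (b * |t|) :=
  (norm_weilMellin_le_weilL1 hf.1.continuous hf.2 hs0 hs1).trans (uniformBound_weilL1_le hf hb)

/-! ## The pointwise bound `‖(f ⋆ h̃₀)(x)‖ ≤ H e^{b r} e^{-b|x|} ∫ ‖f‖ e^{b|t|}` -/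

/-- **Pointwise exponential decay of `f ⋆ h̃₀` in terms of the weighted `L¹` norm of `f`.** If
`‖h₀‖ ≤ H`, `h₀` vanishes off `[-r, r]` and `0 ≤ b`, then for every `x`
`‖(f ⋆ h̃₀)(x)‖ ≤ H e^{b r} (∫ ‖f(t)‖ e^{b|t|} dt) e^{-b|x|}`: indeed
`(f ⋆ h̃₀)(x) = ∫ f(u) conj h₀(u - x) du` and on the support of the integrand `|x| ≤ |u| + r`.
[folklore] -/
theorem uniformBound_norm_weilConv_weilReflect_le {f h₀ : ℝ → ℂ} (hf : IsWeilTest f)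
    {H r b : ℝ} (hH : ∀ x, ‖h₀ x‖ ≤ H) (hr : ∀ x, h₀ x ≠ 0 → |x| ≤ r) (hb : 0 ≤ b) (x : ℝ) :
    ‖weilConv f (weilReflect h₀) x‖ ≤
      H * Real.exp (b * r) * (∫ t : ℝ, ‖f t‖ * Real.exp (b * |t|)) * Real.exp (-(b * |x|)) := by
  rw [weilConv_apply]
  have hH0 : 0 ≤ H := (norm_nonneg _).trans (hH 0)
  have hI : Integrable fun u : ℝ ↦
      H * Real.exp (b * r) * Real.exp (-(b * |x|)) * (‖f u‖ * Real.exp (b * |u|)) :=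
    (uniformBound_integrable_norm_mul hf (by fun_prop)).const_mul _
  refine (norm_integral_le_of_norm_le hI (Eventually.of_forall fun u ↦ ?_)).trans_eq ?_
  · rw [norm_mul]
    simp only [weilReflect, Complex.norm_conj, neg_sub]
    by_cases hu : h₀ (u - x) = 0
    · rw [hu, norm_zero, mul_zero]
      positivity
    · have hux : |u - x| ≤ r := hr _ hu
      have hx : |x| ≤ |u| + r := by
        have h1 := abs_sub_abs_le_abs_sub x u
        rw [abs_sub_comm] at h1
        linarith
      have h1 : 1 ≤ Real.exp (b * r) * Real.exp (-(b * |x|)) * Real.exp (b * |u|) := by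
        rw [← Real.exp_add, ← Real.exp_add]
        refine Real.one_le_exp ?_
        nlinarith [mul_le_mul_of_nonneg_left hx hb]
      calc ‖f u‖ * ‖h₀ (u - x)‖ ≤ ‖f u‖ * H := mul_le_mul_of_nonneg_left (hH _) (norm_nonneg _)
        _ ≤ ‖f u‖ * H * (Real.exp (b * r) * Real.exp (-(b * |x|)) * Real.exp (b * |u|)) :=
            le_mul_of_one_le_right (by positivity) h1
        _ = _ := by ring
  · rw [integral_const_mul]
    ring

/-! ## The prime term -/

/-- `Σ Λ(n) n^{-1/2} e^{-b log n} = Σ Λ(n) n^{-(1/2 + b)}` converges for `b > 1/2` (the Dirichlet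
series of `Λ` converges absolutely for `Re s > 1`, `ArithmeticFunction.LSeriesSummable_vonMangoldt`).
[folklore] -/
theorem uniformBound_summable_vonMangoldt {b : ℝ} (hb : 1 / 2 < b) :
    Summable fun n : ℕ ↦ (Λ n : ℝ) / Real.sqrt n * Real.exp (-(b * Real.log n)) := by
  have hs : 1 < (((1 / 2 + b : ℝ) : ℂ)).re := by rw [Complex.ofReal_re]; linarith
  have h := summable_norm_iff.mpr (ArithmeticFunction.LSeriesSummable_vonMangoldt hs)
  refine h.congr fun n ↦ ?_
  rw [LSeries.norm_term_eq]
  rcases Nat.eq_zero_or_pos n with rfl | hn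
  · simp
  · have hn' : (0 : ℝ) < n := by exact_mod_cast hn
    rw [if_neg hn.ne', Complex.ofReal_re, Complex.norm_real,
      Real.norm_of_nonneg ArithmeticFunction.vonMangoldt_nonneg, Real.rpow_add hn',
      ← Real.sqrt_eq_rpow, Real.rpow_def_of_pos hn', mul_comm (Real.log _) b, Real.exp_neg,
      div_mul_eq_div_div, div_eq_mul_inv _ (Real.exp _)]

/-- **The prime term against an exponentially decaying kernel.** If `‖K(x)‖ ≤ M e^{-b|x|}` and
`Σ Λ(n) n^{-1/2} e^{-b log n}` converges, then
`‖Σ Λ(n) n^{-1/2} (K(log n) + K(-log n))‖ ≤ 2 M Σ Λ(n) n^{-1/2} e^{-b log n}`. [folklore] -/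
theorem uniformBound_norm_weilPrimeTerm_le {K : ℝ → ℂ} {M b : ℝ}
    (hK : ∀ x, ‖K x‖ ≤ M * Real.exp (-(b * |x|)))
    (hS : Summable fun n : ℕ ↦ (Λ n : ℝ) / Real.sqrt n * Real.exp (-(b * Real.log n))) :
    ‖weilPrimeTerm K‖ ≤
      2 * M * ∑' n : ℕ, (Λ n : ℝ) / Real.sqrt n * Real.exp (-(b * Real.log n)) := by
  unfold weilPrimeTerm
  refine tsum_of_norm_bounded (hS.hasSum.mul_left (2 * M)) fun n ↦ ?_
  have hlog : 0 ≤ Real.log (n : ℝ) := Real.log_natCast_nonneg n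
  have h1 : ‖K (Real.log n)‖ ≤ M * Real.exp (-(b * Real.log n)) := by
    simpa [abs_of_nonneg hlog] using hK (Real.log n)
  have h2 : ‖K (-Real.log n)‖ ≤ M * Real.exp (-(b * Real.log n)) := by
    simpa [abs_neg, abs_of_nonneg hlog] using hK (-Real.log n)
  rw [norm_mul, norm_div, Complex.norm_real, Complex.norm_real,
    Real.norm_of_nonneg ArithmeticFunction.vonMangoldt_nonneg,
    Real.norm_of_nonneg (Real.sqrt_nonneg _)]
  calc (Λ n : ℝ) / Real.sqrt n * ‖K (Real.log n) + K (-Real.log n)‖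
      ≤ (Λ n : ℝ) / Real.sqrt n *
          (M * Real.exp (-(b * Real.log n)) + M * Real.exp (-(b * Real.log n))) :=
        mul_le_mul_of_nonneg_left (norm_add_le_of_le h1 h2)
          (div_nonneg ArithmeticFunction.vonMangoldt_nonneg (Real.sqrt_nonneg _))
    _ = 2 * M * ((Λ n : ℝ) / Real.sqrt n * Real.exp (-(b * Real.log n))) := by ring

/-! ## The archimedean integrand -/

/-- The archimedean integrand `t ↦ k̂(1/2 + it) · Re ψ(1/4 + it/2)` of `weilArchIntegral k` is
integrable for every test function `k` (`|k̂| ≤ D/(1 + t²)²` on the critical line and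
`|ψ(1/4 + it/2)| ≤ C + log(1 + |t|)`); same computation as the tree's
`integrable_weilArchIntegrand` (`WeilWindowSimpleEven.lean`). [folklore] -/
theorem uniformBound_integrable_weilArchIntegrand {k : ℝ → ℂ} (hk : IsWeilTest k) :
    Integrable fun t : ℝ ↦ weilMellin k (1 / 2 + t * I) *
      ((Complex.digamma (1 / 4 + t / 2 * I)).re : ℂ) := by
  obtain ⟨C, hC⟩ :=
    Literature.Analysis.SpecialFunctions.Complex.exists_norm_digamma_vertical_le
      (a := 1 / 4) (by norm_num)
  set F : ℝ → ℂ := fun t ↦ ((Complex.digamma (1 / 4 + t / 2 * I)).re : ℂ) with hF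
  have hw : ∀ t : ℝ, (1 / 4 : ℂ) + (t : ℂ) / 2 * I = ((1 / 4 : ℝ) : ℂ) + ((t / 2 : ℝ) : ℂ) * I := by
    intro t
    push_cast
    ring
  have hFc : Continuous F := by
    refine continuous_ofReal.comp (Complex.continuous_re.comp ?_)
    refine Literature.Analysis.SpecialFunctions.Complex.continuousOn_digamma.comp_continuous
      (by fun_prop) fun t ↦ ?_
    rw [hw t]
    simp
  have hFb : ∀ t : ℝ, ‖F t‖ ≤ C + Real.log (1 + |t|) := by
    intro t
    have h1 : ‖F t‖ ≤ ‖Complex.digamma (1 / 4 + t / 2 * I)‖ := by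
      simp only [hF, Complex.norm_real, Real.norm_eq_abs]
      exact Complex.abs_re_le_norm _
    have h2 := hC (t / 2)
    rw [← hw t] at h2
    have h3 : Real.log (1 + |t / 2|) ≤ Real.log (1 + |t|) := by
      refine Real.log_le_log (by positivity) ?_
      rw [abs_div, abs_two]
      linarith [abs_nonneg t]
    linarith
  have hI := integrable_mul_weilMellin_vertical_of_norm_le_log hk (1 / 2) hFc hFb
  refine hI.congr (Eventually.of_forall fun t ↦ ?_)
  simp only [hF]
  rw [mul_comm]
  push_cast
  ring_nf

/-! ## The uniform bound -/

/-- (B) **Uniform bound for the polarised Weil functional in a weighted `L¹` norm.** For a test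
function `h₀` and an exponent `b₀ > 1/2` there is `C ≥ 0` with
`‖W(f ⋆ h̃₀)‖ ≤ C ∫ |f(t)| e^{b₀|t|} dt` for every test function `f` (polar: weight `e^{|t|/2}`;
prime: `|(f ⋆ h̃₀)(±log n)| ≤ H e^{b₀ r} n^{-b₀} ∫|f|e^{b₀|t|}` and `Σ Λ(n) n^{-1/2-b₀} < ∞`;
archimedean: `|f̂(1/2+iτ)| ≤ ∫|f|` against the integrable `|ĥ₀(1/2+iτ)| |Re ψ(1/4+iτ/2)|`).
[folklore] -/
theorem norm_weilFunctional_weilConv_weilReflect_le {h₀ : ℝ → ℂ} (hh₀ : IsWeilTest h₀)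
    {b₀ : ℝ} (hb₀ : 1 / 2 < b₀) :
    ∃ C : ℝ, 0 ≤ C ∧ ∀ f : ℝ → ℂ, IsWeilTest f →
      ‖weilFunctional (weilConv f (weilReflect h₀))‖ ≤ C * ∫ t, ‖f t‖ * Real.exp (b₀ * |t|) := by
  -- data attached to `h₀`
  obtain ⟨H, hH⟩ := hh₀.1.continuous.bounded_above_of_compact_support hh₀.2
  have hH0 : 0 ≤ H := (norm_nonneg _).trans (hH 0)
  obtain ⟨r, hr0, hr⟩ := hh₀.2.isCompact.isBounded.subset_closedBall_lt 0 0
  have hr' : ∀ x, h₀ x ≠ 0 → |x| ≤ r := fun x hx ↦ by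
    have h := hr (subset_tsupport _ hx)
    simpa using h
  have hb0 : 0 < b₀ := by linarith
  have hR : IsWeilTest (weilReflect h₀) := hh₀.weilReflect
  have hSum := uniformBound_summable_vonMangoldt hb₀
  have hInt := uniformBound_integrable_weilArchIntegrand hR
  have hE0 : 0 ≤ H * Real.exp (b₀ * r) := by positivity
  have hS0 : 0 ≤ ∑' n : ℕ, (Λ n : ℝ) / Real.sqrt n * Real.exp (-(b₀ * Real.log n)) :=
    tsum_nonneg fun n ↦ mul_nonneg
      (div_nonneg ArithmeticFunction.vonMangoldt_nonneg (Real.sqrt_nonneg _)) (Real.exp_pos _).le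
  have hA0 : 0 ≤ ∫ t : ℝ, ‖weilMellin (weilReflect h₀) (1 / 2 + t * I) *
      ((Complex.digamma (1 / 4 + t / 2 * I)).re : ℂ)‖ := integral_nonneg fun _ ↦ norm_nonneg _
  refine ⟨(‖weilMellin (weilReflect h₀) 0‖ + ‖weilMellin (weilReflect h₀) 1‖) +
      2 * (H * Real.exp (b₀ * r)) *
        (∑' n : ℕ, (Λ n : ℝ) / Real.sqrt n * Real.exp (-(b₀ * Real.log n))) +
      ‖(1 / (2 * π) : ℂ)‖ * (∫ t : ℝ, ‖weilMellin (weilReflect h₀) (1 / 2 + t * I) *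
        ((Complex.digamma (1 / 4 + t / 2 * I)).re : ℂ)‖) +
      H * Real.exp (b₀ * r) * ‖(Real.log π : ℂ)‖, by positivity, fun f hf ↦ ?_⟩
  set If : ℝ := ∫ t, ‖f t‖ * Real.exp (b₀ * |t|) with hIf
  have hIf0 : 0 ≤ If := integral_nonneg fun _ ↦ by positivity
  set K : ℝ → ℂ := weilConv f (weilReflect h₀) with hKdef
  -- Mellin factorisation and the strip bound for `f̂`
  have hMK : ∀ s, weilMellin K s = weilMellin f s * weilMellin (weilReflect h₀) s :=
    weilMellin_weilConv_holds hf.1.continuous hf.2 hR.1.continuous hR.2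
  have hfM : ∀ s : ℂ, 0 ≤ s.re → s.re ≤ 1 → ‖weilMellin f s‖ ≤ If := fun s h0 h1 ↦
    uniformBound_norm_weilMellin_le hf hb₀.le h0 h1
  -- pointwise bound on `K`
  have hKx : ∀ x, ‖K x‖ ≤ H * Real.exp (b₀ * r) * If * Real.exp (-(b₀ * |x|)) := fun x ↦
    uniformBound_norm_weilConv_weilReflect_le hf hH hr' hb0.le x
  -- polar term
  have hPol : ‖weilPolarTerm K‖ ≤
      (‖weilMellin (weilReflect h₀) 0‖ + ‖weilMellin (weilReflect h₀) 1‖) * If := by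
    rw [weilPolarTerm, hMK, hMK]
    calc ‖weilMellin f 0 * weilMellin (weilReflect h₀) 0 +
          weilMellin f 1 * weilMellin (weilReflect h₀) 1‖
        ≤ ‖weilMellin f 0‖ * ‖weilMellin (weilReflect h₀) 0‖ +
            ‖weilMellin f 1‖ * ‖weilMellin (weilReflect h₀) 1‖ :=
          (norm_add_le _ _).trans_eq (by rw [norm_mul, norm_mul])
      _ ≤ If * ‖weilMellin (weilReflect h₀) 0‖ + If * ‖weilMellin (weilReflect h₀) 1‖ := by
          gcongr
          · exact hfM 0 (by simp) (by simp)
          · exact hfM 1 (by simp) (by simp)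
      _ = _ := by ring
  -- prime term
  have hPr : ‖weilPrimeTerm K‖ ≤ 2 * (H * Real.exp (b₀ * r) * If) *
      ∑' n : ℕ, (Λ n : ℝ) / Real.sqrt n * Real.exp (-(b₀ * Real.log n)) :=
    uniformBound_norm_weilPrimeTerm_le hKx hSum
  -- archimedean term
  have hAI : ‖weilArchIntegral K‖ ≤ If * ∫ t : ℝ, ‖weilMellin (weilReflect h₀) (1 / 2 + t * I) *
      ((Complex.digamma (1 / 4 + t / 2 * I)).re : ℂ)‖ := by
    unfold weilArchIntegral
    refine (norm_integral_le_of_norm_le (hInt.norm.const_mul If)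
      (Eventually.of_forall fun t ↦ ?_)).trans_eq (integral_const_mul _ _)
    rw [hMK, mul_assoc, norm_mul]
    exact mul_le_mul_of_nonneg_right (hfM _ (by simp) (by norm_num)) (norm_nonneg _)
  have hK0 : ‖K 0‖ ≤ H * Real.exp (b₀ * r) * If := by simpa using hKx 0
  have hArch : ‖weilArchTerm K‖ ≤
      ‖(1 / (2 * π) : ℂ)‖ * (If * ∫ t : ℝ, ‖weilMellin (weilReflect h₀) (1 / 2 + t * I) *
        ((Complex.digamma (1 / 4 + t / 2 * I)).re : ℂ)‖) +
      H * Real.exp (b₀ * r) * If * ‖(Real.log π : ℂ)‖ := by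
    unfold weilArchTerm
    refine (norm_sub_le _ _).trans ?_
    rw [norm_mul, norm_mul]
    exact add_le_add (mul_le_mul_of_nonneg_left hAI (norm_nonneg _))
      (mul_le_mul_of_nonneg_right hK0 (norm_nonneg _))
  -- assembly
  calc ‖weilFunctional K‖ ≤ ‖weilPolarTerm K‖ + ‖weilPrimeTerm K‖ + ‖weilArchTerm K‖ :=
        norm_add_le_of_le (norm_sub_le _ _) le_rfl
    _ ≤ _ := add_le_add (add_le_add hPol hPr) hArch
    _ = _ := by ring

end Summit.RiemannHypothesis.RiemannHypothesis.Theorems.GroundStatesConvergeToXi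

end
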